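import Summits.ResolutionOfSingularities.ResolutionOfSingularities.Theorems.FrobeniusLadderFRationalResolutionDoubleColonOfSocleCyclic
import Summits.ResolutionOfSingularities.ResolutionOfSingularities.Theorems.FrobeniusLadderFRationalResolutionColonTightlyClosed
import Summits.ResolutionOfSingularities.ResolutionOfSingularities.Theorems.FrobeniusLadderFRationalResolutionClauseOfMPrimary
import Summits.ResolutionOfSingularities.ResolutionOfSingularities.Theorems.FrobeniusLadderFRationalResolutionSopLeOfMPrimary
import Summits.ResolutionOfSingularities.ResolutionOfSingularities.Theorems.FrobeniusLadderFRationalResolutionSocleCyclicOfCI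
import Summits.ResolutionOfSingularities.ResolutionOfSingularities.Theorems.FrobeniusLadderFRationalResolutionHypersurfaceQuotientData
import Summits.ResolutionOfSingularities.ResolutionOfSingularities.Theorems.FrobeniusLadderFRationalResolutionSpecHypersurface
import Summits.ResolutionOfSingularities.ResolutionOfSingularities.Theorems.FrobeniusLadderFRationalResolutionStubClauseOfRingEquiv
import Literature.AlgebraicGeometry.Resolution.ResolutionOfSingularities
import Literature.RingTheory.TightClosure.FRationalNormal
import HarnessLib

/-!
# Rung 3½ on the Gorenstein sector: F-rational ⇒ weakly F-regular when parameter ideals have cyclic socle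

Support file for crux stmt-ResolutionOfSingularities-15317 (`FrobeniusLadder.FRationalResolution`),
line `Sketch`, continuation seat c3 (2026-08-17): the ASSEMBLY of the c3 wave-1 stubs
(`stub_doubleColon_of_socle_cyclic` p139297, `stub_colon_tightlyClosed` p139077,
`stub_clause_of_mPrimary` p139081, `stub_sop_le_of_mPrimary` p139156, `stub_socle_cyclic_of_ci`
p139167, `stub_hypersurface_quotient_data` p139176).

Hochster–Huneke: an F-rational GORENSTEIN local ring is (weakly) F-regular (Hochster–Huneke 1994,
Thm. 4.2 / Cor. 4.7; Fedder–Watanabe 1989, Prop. 2.2 for hypersurfaces; Huneke, *Tight closure and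
its applications*, Thm. 4.2). In the tree's vocabulary, with the crux's INLINE clauses and without
`Ext`, injective hulls or Matlis duality:

* `weaklyFRegular_of_fRational_of_socle_cyclic` — ring level, abstract: `(R, 𝔪)` Noetherian local
  of characteristic `p`; if every parameter ideal (`dim R` elements, maximal radical) is tightly
  closed (the crux's F-rational clause) AND has cyclic socle `(q : 𝔪) = q + (t)`, then EVERY ideal
  is tightly closed (the weakly-F-regular clause of rungs 3½/4′). Proof: Krull reduces to
  `𝔪`-primary `I`; a parameter ideal `q ⊆ I`; `q : (q : I) = I` (double annihilator, by a LENGTH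
  COUNT); colons of the tightly closed `q` are tightly closed.
* `weaklyFRegular_of_fRational_of_ci` — complete-intersection quotients `R = S/(g₁, …, g_c)` of a
  regular local ring, `c = dim S − dim R` (their parameter ideals lift to parameter ideals of `S`,
  whose socles are cyclic: Matsumura 18.1, tree file `ParameterIdealSocle.lean`).
* `weaklyFRegular_of_fRational_hypersurface` — hypersurface local rings `S/(g)`, `0 ≠ g ∈ 𝔪_S`.
* `weaklyFRegular_stalk_hypersurface_of_fRational`, `rung3half_hypersurface` — scheme form: for a
  regular domain `S` (e.g. `k[x₁..xₙ]`, Mathlib `IsRegularRing`) and `0 ≠ g`, an F-rational stalk of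
  `X = Spec (S ⧸ (g))` is weakly F-regular, so `X` with F-rational stalks is ITS OWN weakly F-regular
  proper birational model: the conclusion of rung 3½ (`stub_weaklyFRegularModification`) holds with
  `π = 𝟙 X`.

Consequence for the crux (with the c2 calibration `Σf = {yz + f = 0}`, which lies in this sector
and carries every hypersurface singularity two dimensions down): on the hypersurface sector the
crux IS rung 4′ (skeleton theorem `hypersurfaceCore_of_rung4`); the non-trivial content of rung 3½
lives exactly in the non-Gorenstein sector, where F-rational ⊋ weakly F-regular.

References: M. Hochster, C. Huneke, *F-regularity, test elements, and smooth base change*, Trans.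
AMS 346 (1994), Thm. 4.2; R. Fedder, K.-i. Watanabe, *A characterization of F-regularity in terms
of F-purity* (1989), Prop. 2.2; H. Matsumura, *Commutative Ring Theory*, Thm. 18.1;
W. Bruns, J. Herzog, *Cohen–Macaulay rings*, 3.2.15.
-/

-- single-problem summit: the doubled namespace component is forced
set_option linter.dupNamespace false

noncomputable section

namespace Summit.ResolutionOfSingularities.ResolutionOfSingularities.Theorems.FRationalResolution

open CategoryTheory AlgebraicGeometry TopologicalSpace
open Literature.AlgebraicGeometry.Resolution

/-- **F-RATIONAL ⇒ WEAKLY F-REGULAR WHEN PARAMETER IDEALS HAVE CYCLIC SOCLE** (Hochster–Huneke's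
"F-rational Gorenstein rings are F-regular", ring level, inline clauses). `(R, 𝔪)` Noetherian local of
prime characteristic `p`; if every ideal generated by a system of parameters (`dim R` elements, maximal
radical) is tightly closed in the crux's inline sense AND has cyclic socle, then EVERY ideal of `R` is
tightly closed in the inline sense. (Krull reduction to `𝔪`-primary `I`; a parameter ideal `q ⊆ I`;
`q : (q : I) = I` by the double annihilator; colons of the tightly closed `q` are tightly closed.) -/
theorem weaklyFRegular_of_fRational_of_socle_cyclic (p : ℕ) (R : Type) [CommRing R]
    [IsNoetherianRing R] [IsLocalRing R]
    (hFR : ∀ d : ℕ, ringKrullDim R = d → ∀ s : Fin d → R,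
      (Ideal.span (Set.range s)).radical.IsMaximal → ∀ y c : R, c ≠ 0 →
      (∀ e : ℕ, c * y ^ p ^ e ∈ Ideal.span ((fun z : R => z ^ p ^ e) ''
        (Ideal.span (Set.range s) : Set R))) → y ∈ Ideal.span (Set.range s))
    (hsoc : ∀ d : ℕ, ringKrullDim R = d → ∀ s : Fin d → R,
      (Ideal.span (Set.range s)).radical.IsMaximal →
      ∃ t : R, (Ideal.span (Set.range s)).colon (IsLocalRing.maximalIdeal R : Set R) =
        Ideal.span (Set.range s) ⊔ Ideal.span {t})
    (I : Ideal R) (y c : R) (hc : c ≠ 0)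
    (hy : ∀ e : ℕ, c * y ^ p ^ e ∈ Ideal.span ((fun z : R => z ^ p ^ e) '' (I : Set R))) :
    y ∈ I := by
  refine stub_clause_of_mPrimary p R (fun I hI y c hc hy => ?_) I y c hc hy
  obtain ⟨N, hN⟩ := hI
  obtain ⟨d, hd⟩ : ∃ d : ℕ, ringKrullDim R = d :=
    Literature.RingTheory.TightClosure.exists_ringKrullDim_eq_nat
  obtain ⟨s, hsmax, hsI, M, hM⟩ := stub_sop_le_of_mPrimary R d hd I N hN
  obtain ⟨t, ht⟩ := hsoc d hd s hsmax
  have hqI := stub_doubleColon_of_socle_cyclic R (Ideal.span (Set.range s)) M hM t ht I hsI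
  rw [← hqI]
  refine stub_colon_tightlyClosed p R (Ideal.span (Set.range s)) _ (hFR d hd s hsmax) y c hc ?_
  rw [hqI]
  exact hy

/-- **F-RATIONAL ⇒ WEAKLY F-REGULAR FOR COMPLETE INTERSECTIONS** (rung 3½ with the identity model on
the Gorenstein sector, ring level): if `R` is a local quotient of a regular local ring `S` by
`c = dim S − dim R` equations and every parameter ideal of `R` is tightly closed (inline clause), then
every ideal of `R` is tightly closed (inline clause). In particular HYPERSURFACE local rings
`S/(g)` — among them every stalk of the calibration family `Σf` and of every hypersurface of affine
space — are F-rational iff weakly F-regular. -/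
theorem weaklyFRegular_of_fRational_of_ci (p : ℕ) (S R : Type) [CommRing S] [IsRegularLocalRing S]
    [CommRing R] [IsNoetherianRing R] [IsLocalRing R] (f : S →+* R) (hf : Function.Surjective f)
    (G : List S) (hker : RingHom.ker f = Ideal.ofList G) (d : ℕ) (hd : ringKrullDim R = d)
    (hdim : ((G.length + d : ℕ) : WithBot ℕ∞) = ringKrullDim S)
    (hFR : ∀ d : ℕ, ringKrullDim R = d → ∀ s : Fin d → R,
      (Ideal.span (Set.range s)).radical.IsMaximal → ∀ y c : R, c ≠ 0 →
      (∀ e : ℕ, c * y ^ p ^ e ∈ Ideal.span ((fun z : R => z ^ p ^ e) ''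
        (Ideal.span (Set.range s) : Set R))) → y ∈ Ideal.span (Set.range s))
    (I : Ideal R) (y c : R) (hc : c ≠ 0)
    (hy : ∀ e : ℕ, c * y ^ p ^ e ∈ Ideal.span ((fun z : R => z ^ p ^ e) '' (I : Set R))) :
    y ∈ I := by
  refine weaklyFRegular_of_fRational_of_socle_cyclic p R hFR (fun d' hd' s hs => ?_) I y c hc hy
  have hdd : d' = d := by
    have h := hd'.symm.trans hd
    exact_mod_cast h
  subst hdd
  exact stub_socle_cyclic_of_ci S R f hf G hker d' hdim s hs

/-- **HYPERSURFACE LOCAL RINGS: F-RATIONAL ⇒ WEAKLY F-REGULAR** (Fedder–Watanabe 1989 Prop. 2.2 /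
Hochster–Huneke 1994 for Gorenstein rings, the hypersurface case, inline clauses): for a regular
local ring `S` and `0 ≠ g ∈ 𝔪_S`, if every parameter ideal of `S/(g)` is tightly closed then every
ideal of `S/(g)` is tightly closed. Every stalk of the calibration family `Σf` (c2) and of every
hypersurface in a smooth `k`-variety has this shape; on that sector rung 3½ costs nothing. -/
theorem weaklyFRegular_of_fRational_hypersurface (p : ℕ) (S : Type) [CommRing S]
    [IsRegularLocalRing S] (g : S) (hg : g ∈ IsLocalRing.maximalIdeal S) (hg0 : g ≠ 0)
    (hFR : ∀ d : ℕ, ringKrullDim (S ⧸ Ideal.span {g}) = d → ∀ s : Fin d → S ⧸ Ideal.span {g},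
      (Ideal.span (Set.range s)).radical.IsMaximal → ∀ y c : S ⧸ Ideal.span {g}, c ≠ 0 →
      (∀ e : ℕ, c * y ^ p ^ e ∈ Ideal.span ((fun z : S ⧸ Ideal.span {g} => z ^ p ^ e) ''
        (Ideal.span (Set.range s) : Set (S ⧸ Ideal.span {g})))) → y ∈ Ideal.span (Set.range s))
    (I : Ideal (S ⧸ Ideal.span {g})) (y c : S ⧸ Ideal.span {g}) (hc : c ≠ 0)
    (hy : ∀ e : ℕ, c * y ^ p ^ e ∈
      Ideal.span ((fun z : S ⧸ Ideal.span {g} => z ^ p ^ e) '' (I : Set (S ⧸ Ideal.span {g})))) :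
    y ∈ I := by
  obtain ⟨hnt, hker, d, hd, hdim⟩ := stub_hypersurface_quotient_data S g hg hg0
  haveI := hnt
  haveI : IsLocalRing (S ⧸ Ideal.span {g}) := .of_surjective' _ Ideal.Quotient.mk_surjective
  exact weaklyFRegular_of_fRational_of_ci p S (S ⧸ Ideal.span {g}) (Ideal.Quotient.mk _)
    Ideal.Quotient.mk_surjective [g] hker d hd hdim hFR I y c hc hy

/-! ## Scheme form: rung 3½ holds with the identity model on hypersurfaces in regular ambients -/

/-- **F-RATIONAL STALKS OF A HYPERSURFACE ARE WEAKLY F-REGULAR.** Let `S` be a regular domain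
(e.g. `k[x₁, …, xₙ]`), `0 ≠ g ∈ S` and `X = Spec (S ⧸ (g))`. If the stalk `𝒪_{X,x}` satisfies the
crux's F-rational clause (domain, every parameter ideal tightly closed), then EVERY ideal of `𝒪_{X,x}`
is tightly closed (the weakly-F-regular clause of rungs 3½/4′): `𝒪_{X,x} ≅ S_P ⧸ (g)` for `P` the
preimage of `x` (`nonempty_stalk_ringEquiv_localization_quotient`, W6), `S_P` is regular local, and
`weaklyFRegular_of_fRational_hypersurface` applies; both clauses transport along ring isomorphisms. -/
theorem weaklyFRegular_stalk_hypersurface_of_fRational (p : ℕ) (S : Type) [CommRing S] [IsDomain S]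
    [IsRegularRing S] (g : S) (hg0 : g ≠ 0) (x : Spec (CommRingCat.of (S ⧸ Ideal.span {g})))
    (hFR : IsDomain ((Spec (CommRingCat.of (S ⧸ Ideal.span {g}))).presheaf.stalk x) ∧
      ∀ d : ℕ, ringKrullDim ((Spec (CommRingCat.of (S ⧸ Ideal.span {g}))).presheaf.stalk x) = d →
      ∀ s : Fin d → (Spec (CommRingCat.of (S ⧸ Ideal.span {g}))).presheaf.stalk x,
      (Ideal.span (Set.range s)).radical.IsMaximal →
      ∀ y c : (Spec (CommRingCat.of (S ⧸ Ideal.span {g}))).presheaf.stalk x, c ≠ 0 →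
      (∀ e : ℕ, c * y ^ p ^ e ∈ Ideal.span
        ((fun z : (Spec (CommRingCat.of (S ⧸ Ideal.span {g}))).presheaf.stalk x => z ^ p ^ e) ''
          (Ideal.span (Set.range s) :
            Set ((Spec (CommRingCat.of (S ⧸ Ideal.span {g}))).presheaf.stalk x)))) →
      y ∈ Ideal.span (Set.range s)) :
    IsDomain ((Spec (CommRingCat.of (S ⧸ Ideal.span {g}))).presheaf.stalk x) ∧
      ∀ (I : Ideal ((Spec (CommRingCat.of (S ⧸ Ideal.span {g}))).presheaf.stalk x))
        (y c : (Spec (CommRingCat.of (S ⧸ Ideal.span {g}))).presheaf.stalk x), c ≠ 0 →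
        (∀ e : ℕ, c * y ^ p ^ e ∈ Ideal.span
          ((fun z : (Spec (CommRingCat.of (S ⧸ Ideal.span {g}))).presheaf.stalk x => z ^ p ^ e) ''
            (I : Set ((Spec (CommRingCat.of (S ⧸ Ideal.span {g}))).presheaf.stalk x)))) →
        y ∈ I := by
  set P : Ideal S := x.asIdeal.comap (Ideal.Quotient.mk (Ideal.span {g})) with hP
  haveI hPprime : P.IsPrime := Ideal.comap_isPrime _ _
  obtain ⟨e⟩ :=
    nonempty_stalk_ringEquiv_localization_quotient S g x P rfl
  have hgP : g ∈ P := by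
    rw [hP, Ideal.mem_comap, Ideal.Quotient.eq_zero_iff_mem.mpr (Ideal.mem_span_singleton_self g)]
    exact zero_mem _
  have hg' : algebraMap S (Localization.AtPrime P) g ∈
      IsLocalRing.maximalIdeal (Localization.AtPrime P) := by
    rw [← Localization.AtPrime.map_eq_maximalIdeal]
    exact Ideal.mem_map_of_mem _ hgP
  have hg'0 : algebraMap S (Localization.AtPrime P) g ≠ 0 := fun h => hg0 <|
    (IsLocalization.injective (Localization.AtPrime P) P.primeCompl_le_nonZeroDivisors)
      (h.trans (map_zero _).symm)
  have hFR' := ClauseInvariance.stub_clause_of_ringEquiv p e hFR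
  refine ⟨hFR.1, allIdeals_clause_of_ringEquiv p e ?_⟩
  intro I y c hc hy
  exact weaklyFRegular_of_fRational_hypersurface p (Localization.AtPrime P)
    (algebraMap S (Localization.AtPrime P) g) hg' hg'0 hFR'.2 I y c hc hy

/-- **RUNG 3½ ON THE HYPERSURFACE SECTOR (scheme form).** For a regular domain `S`, `0 ≠ g ∈ S` and
`X = Spec (S ⧸ (g))` all of whose stalks satisfy the F-rational clause, `X` is ITS OWN weakly F-regular
proper birational model: the conclusion of `stub_weaklyFRegularModification` holds with `π = 𝟙 X`.
By the c2 calibration this sector (the suspensions `Σf`, `S = k[y, z, x]`, `g = yz + f`) already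
carries every hypersurface singularity two dimensions down; there the crux IS rung 4′. -/
theorem rung3half_hypersurface (p : ℕ) (S : Type) [CommRing S] [IsDomain S] [IsRegularRing S]
    (g : S) (hg0 : g ≠ 0)
    (hFR : ∀ x : Spec (CommRingCat.of (S ⧸ Ideal.span {g})),
      IsDomain ((Spec (CommRingCat.of (S ⧸ Ideal.span {g}))).presheaf.stalk x) ∧
      ∀ d : ℕ, ringKrullDim ((Spec (CommRingCat.of (S ⧸ Ideal.span {g}))).presheaf.stalk x) = d →
      ∀ s : Fin d → (Spec (CommRingCat.of (S ⧸ Ideal.span {g}))).presheaf.stalk x,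
      (Ideal.span (Set.range s)).radical.IsMaximal →
      ∀ y c : (Spec (CommRingCat.of (S ⧸ Ideal.span {g}))).presheaf.stalk x, c ≠ 0 →
      (∀ e : ℕ, c * y ^ p ^ e ∈ Ideal.span
        ((fun z : (Spec (CommRingCat.of (S ⧸ Ideal.span {g}))).presheaf.stalk x => z ^ p ^ e) ''
          (Ideal.span (Set.range s) :
            Set ((Spec (CommRingCat.of (S ⧸ Ideal.span {g}))).presheaf.stalk x)))) →
      y ∈ Ideal.span (Set.range s)) :
    ∃ (X' : Scheme.{0}) (π : X' ⟶ Spec (CommRingCat.of (S ⧸ Ideal.span {g}))),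
      IsProper π ∧ IsBirational π ∧
      ∀ x : X', IsDomain (X'.presheaf.stalk x) ∧ ∀ I : Ideal (X'.presheaf.stalk x),
        ∀ y c : X'.presheaf.stalk x, c ≠ 0 →
        (∀ e : ℕ, c * y ^ p ^ e ∈ Ideal.span ((fun z : X'.presheaf.stalk x => z ^ p ^ e) ''
          (I : Set (X'.presheaf.stalk x)))) → y ∈ I := by
  refine ⟨_, 𝟙 _, inferInstance, ⟨⊤, ?_, ?_, ?_⟩,
    fun x => weaklyFRegular_stalk_hypersurface_of_fRational p S g hg0 x (hFR x)⟩
  · simp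
  · simp
  · infer_instance

end Summit.ResolutionOfSingularities.ResolutionOfSingularities.Theorems.FRationalResolution

end
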